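import Mathlib
import Summits.NavierStokesRegularity.NavierStokesRegularity.Theorems.EulerZoomLiouvillePowerGaugeEulerLiouvilleCasimirHaulBookTools
import Summits.NavierStokesRegularity.NavierStokesRegularity.Theorems.EulerZoomLiouvillePowerGaugeEulerLiouvilleCasimirHaulTravelTools
import Literature.Analysis.FluidPDE.ClassicalSolution
import Literature.Analysis.FluidPDE.AxisymmetricEuler
import HarnessLib

/-!
# Crux `EulerZoomLiouville.PowerGaugeEulerLiouville` (stmt-NavierStokesRegularity-19832), width sub-line `casimir_haul` (ns-idea-11, REV3),
# stub H4c `stub_haulBook` — part (b): THE PER-SLICE MAJORANT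

Seat ns-sfl-p1 g10 (`--supports stmt-NavierStokesRegularity-19832 --as helper`).  Port BY NAME of the H4c toolkit of
`Cruxes/PowerGaugeEulerLiouville/Lines/casimir_haul.lean` REV3 (sha16 31279a74fac8e2c7; proofs by ns-idea-11 g11, in-file, sorry-free), §«Geometry of the
solid cylinder and the shell», §«Per-slice measure lemmas», §«The per-slice axial flux bound», §«Per-slice majorant», VERBATIM up to: the line's
`solidCyl b = {r < 2b ∧ |x₂| < b}`, `haulShell b = {x ∈ B(0,3b) ∧ b ≤ r}`, `axisMoment A = ∫_A r²` and `HaulingInequality` are δ-UNFOLDED, and the image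
`X_s S` of the ledger flow is replaced by an arbitrary measurable set `Y` (only its measurability is used per slice).

* `measurableSet_solidCyl'`, `measurableSet_haulShell'`, `solidCyl_subset_ball'`;
* `shell_volume_le` (`b²|Y ∩ shell| ≤ ∫_{Y ∩ B_{3b}} r²`), `shell_traffic_le` (Young), `moment_ball_lt_top`, `ball_sq_lt_top`;
* `axial_flux_le` — per-slice AXIAL FLUX bound from the hauling inequality + `moment_log_bound` + AM–GM;
* ★ `slice_majorant` — flux + shell traffic `≤ α·D̂(s) + β·m̂(s) + γ`.
Part (c) `…CasimirHaulBook` integrates this in time against the gauge budgets.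

HONEST FRAMING: per-slice real analysis for a width sub-line of the crux class; nothing here bears on the crux E (19832 OPEN) or on NS regularity; not E.
[folklore; cite: CaffarelliKohnNirenberg1982, §2 (parabolic gauges)]
-/

noncomputable section

-- flat `Theorems/<Route><Decl>…` files of one crux share the namespace of the crux (tree convention)
set_option linter.dupNamespace false

open MeasureTheory Set Filter Topology Metric Function
open scoped NNReal ENNReal

namespace Summit.NavierStokesRegularity.NavierStokesRegularity.Theorems.PowerGaugeEulerLiouville.CasimirHaul

open Literature.Analysis Literature.Analysis.FluidPDE

/-- The solid cylinder is measurable (open). [folklore] -/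
theorem measurableSet_solidCyl' (b : ℝ) : MeasurableSet {x : EuclideanSpace ℝ (Fin 3) | cylRadius x < 2 * b ∧ |x 2| < b} :=
  ((isOpen_lt continuous_cylRadius continuous_const).inter
    (isOpen_lt (continuous_abs.comp (EuclideanSpace.proj (2 : Fin 3) : EuclideanSpace ℝ (Fin 3) →L[ℝ] ℝ).continuous)
      continuous_const)).measurableSet

/-- The shell is measurable. [folklore] -/
theorem measurableSet_haulShell' (b : ℝ) :
    MeasurableSet {x : EuclideanSpace ℝ (Fin 3) | x ∈ Metric.ball (0 : EuclideanSpace ℝ (Fin 3)) (3 * b) ∧ b ≤ cylRadius x} :=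
  measurableSet_ball.inter (measurableSet_le measurable_const continuous_cylRadius.measurable)

/-- The solid cylinder `{r < 2b, |x₂| < b}` lies in `B(0,3b)`. (ns-idea-11 g11, ported; `solidCyl` δ-unfolded.) [folklore] -/
theorem solidCyl_subset_ball' {b : ℝ} (hb : 0 < b) : {x : EuclideanSpace ℝ (Fin 3) | cylRadius x < 2 * b ∧ |x 2| < b} ⊆ Metric.ball (0 : EuclideanSpace ℝ (Fin 3)) (3 * b) := by
  intro x hx
  obtain ⟨hr, hz⟩ := hx
  rw [Metric.mem_ball, dist_zero_right]
  have h1 : ‖x‖ ^ 2 < (3 * b) ^ 2 := by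
    rw [show ‖x‖ ^ 2 = cylRadius x ^ 2 + x 2 ^ 2 by
      rw [cylRadius_sq, EuclideanSpace.norm_sq_eq, Fin.sum_univ_three]; simp only [Real.norm_eq_abs, sq_abs]]
    have hz2 : x 2 ^ 2 < b ^ 2 := by
      have := abs_lt.1 hz
      nlinarith [this.1, this.2]
    nlinarith [cylRadius_nonneg x, hr, hz2]
  nlinarith [norm_nonneg x, h1]

/-- On the shell `r ≥ b`, so `b² |Y ∩ shell| ≤ ∫_{Y ∩ B_{3b}} r²` (`Y = X_sS`). (ns-idea-11 g11, ported.) [folklore] -/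
theorem shell_volume_le {Y : Set (EuclideanSpace ℝ (Fin 3))} (hY : MeasurableSet Y) {b : ℝ} (hb : 0 ≤ b) :
    ENNReal.ofReal (b ^ 2) * volume (Y ∩ {x : EuclideanSpace ℝ (Fin 3) | x ∈ Metric.ball (0 : EuclideanSpace ℝ (Fin 3)) (3 * b) ∧ b ≤ cylRadius x}) ≤
      ∫⁻ x in Y ∩ Metric.ball (0 : EuclideanSpace ℝ (Fin 3)) (3 * b), ENNReal.ofReal (cylRadius x ^ 2) := by
  have hT : MeasurableSet (Y ∩ {x : EuclideanSpace ℝ (Fin 3) | x ∈ Metric.ball (0 : EuclideanSpace ℝ (Fin 3)) (3 * b) ∧ b ≤ cylRadius x}) := hY.inter (measurableSet_haulShell' b)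
  calc ENNReal.ofReal (b ^ 2) * volume (Y ∩ {x : EuclideanSpace ℝ (Fin 3) | x ∈ Metric.ball (0 : EuclideanSpace ℝ (Fin 3)) (3 * b) ∧ b ≤ cylRadius x})
      = ∫⁻ _ in Y ∩ {x : EuclideanSpace ℝ (Fin 3) | x ∈ Metric.ball (0 : EuclideanSpace ℝ (Fin 3)) (3 * b) ∧ b ≤ cylRadius x}, ENNReal.ofReal (b ^ 2) := by rw [setLIntegral_const]
    _ ≤ ∫⁻ x in Y ∩ {x : EuclideanSpace ℝ (Fin 3) | x ∈ Metric.ball (0 : EuclideanSpace ℝ (Fin 3)) (3 * b) ∧ b ≤ cylRadius x}, ENNReal.ofReal (cylRadius x ^ 2) := by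
        refine setLIntegral_mono' hT fun x hx => ENNReal.ofReal_le_ofReal ?_
        exact pow_le_pow_left₀ hb hx.2.2 2
    _ ≤ ∫⁻ x in Y ∩ Metric.ball (0 : EuclideanSpace ℝ (Fin 3)) (3 * b), ENNReal.ofReal (cylRadius x ^ 2) :=
        lintegral_mono_set (Set.inter_subset_inter_right _ (fun x (hx : x ∈ {x : EuclideanSpace ℝ (Fin 3) | x ∈ Metric.ball (0 : EuclideanSpace ℝ (Fin 3)) (3 * b) ∧ b ≤ cylRadius x}) => hx.1))

/-- Shell traffic by Young: `∫_{T} |u| ≤ (θ/2)|T| + (1/2θ) ∫_{B_{3b}} |u|²`, `T = Y ∩ shell`. (ns-idea-11 g11, ported.) [folklore] -/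
theorem shell_traffic_le {u : ℝ → EuclideanSpace ℝ (Fin 3) → EuclideanSpace ℝ (Fin 3)} {p : ℝ → EuclideanSpace ℝ (Fin 3) → ℝ}
    (hcl : IsClassicalEulerSolutionOn (Set.Iio 0) 0 u p)
    {Y : Set (EuclideanSpace ℝ (Fin 3))} (hY : MeasurableSet Y) (b : ℝ) {s : ℝ} (hs0 : s < 0) {θ : ℝ} (hθ : 0 < θ) :
    ∫⁻ x in Y ∩ {x : EuclideanSpace ℝ (Fin 3) | x ∈ Metric.ball (0 : EuclideanSpace ℝ (Fin 3)) (3 * b) ∧ b ≤ cylRadius x}, ‖u s x‖ₑ ≤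
      ENNReal.ofReal (θ / 2) * volume (Y ∩ {x : EuclideanSpace ℝ (Fin 3) | x ∈ Metric.ball (0 : EuclideanSpace ℝ (Fin 3)) (3 * b) ∧ b ≤ cylRadius x}) +
        ENNReal.ofReal (1 / (2 * θ)) * ∫⁻ x in Metric.ball (0 : EuclideanSpace ℝ (Fin 3)) (3 * b), ‖u s x‖ₑ ^ 2 := by
  have hT : MeasurableSet (Y ∩ {x : EuclideanSpace ℝ (Fin 3) | x ∈ Metric.ball (0 : EuclideanSpace ℝ (Fin 3)) (3 * b) ∧ b ≤ cylRadius x}) := hY.inter (measurableSet_haulShell' b)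
  have hv : Continuous (u s) := ((hcl.contDiff_velocity (show s ∈ Set.Iio 0 from hs0)).of_le
    (by norm_cast : ((0 : ℕ) : WithTop ℕ∞) ≤ _)).continuous
  have hgm : Measurable fun x => ‖u s x‖ₑ ^ 2 := (hv.measurable.enorm).pow_const 2
  have hpt : ∀ x, ‖u s x‖ₑ ≤ ENNReal.ofReal (θ / 2) + ENNReal.ofReal (1 / (2 * θ)) * ‖u s x‖ₑ ^ 2 := by
    intro x
    have h1 := le_young (t := ‖u s x‖) hθ
    rw [← ofReal_norm, ← ENNReal.ofReal_pow (norm_nonneg _), ← ENNReal.ofReal_mul (by positivity),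
      ← ENNReal.ofReal_add (by positivity) (by positivity)]
    refine ENNReal.ofReal_le_ofReal ?_
    calc ‖u s x‖ ≤ θ / 2 + ‖u s x‖ ^ 2 / (2 * θ) := h1
      _ = θ / 2 + 1 / (2 * θ) * ‖u s x‖ ^ 2 := by ring
  calc ∫⁻ x in Y ∩ {x : EuclideanSpace ℝ (Fin 3) | x ∈ Metric.ball (0 : EuclideanSpace ℝ (Fin 3)) (3 * b) ∧ b ≤ cylRadius x}, ‖u s x‖ₑ
      ≤ ∫⁻ x in Y ∩ {x : EuclideanSpace ℝ (Fin 3) | x ∈ Metric.ball (0 : EuclideanSpace ℝ (Fin 3)) (3 * b) ∧ b ≤ cylRadius x}, (ENNReal.ofReal (θ / 2) + ENNReal.ofReal (1 / (2 * θ)) * ‖u s x‖ₑ ^ 2) :=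
        lintegral_mono fun x => hpt x
    _ = ENNReal.ofReal (θ / 2) * volume (Y ∩ {x : EuclideanSpace ℝ (Fin 3) | x ∈ Metric.ball (0 : EuclideanSpace ℝ (Fin 3)) (3 * b) ∧ b ≤ cylRadius x}) +
          ENNReal.ofReal (1 / (2 * θ)) * ∫⁻ x in Y ∩ {x : EuclideanSpace ℝ (Fin 3) | x ∈ Metric.ball (0 : EuclideanSpace ℝ (Fin 3)) (3 * b) ∧ b ≤ cylRadius x}, ‖u s x‖ₑ ^ 2 := by
        rw [lintegral_add_left (measurable_const), setLIntegral_const, lintegral_const_mul _ hgm]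
    _ ≤ ENNReal.ofReal (θ / 2) * volume (Y ∩ {x : EuclideanSpace ℝ (Fin 3) | x ∈ Metric.ball (0 : EuclideanSpace ℝ (Fin 3)) (3 * b) ∧ b ≤ cylRadius x}) +
          ENNReal.ofReal (1 / (2 * θ)) * ∫⁻ x in Metric.ball (0 : EuclideanSpace ℝ (Fin 3)) (3 * b), ‖u s x‖ₑ ^ 2 := by
        gcongr
        exact Set.inter_subset_right.trans (fun x (hx : x ∈ {x : EuclideanSpace ℝ (Fin 3) | x ∈ Metric.ball (0 : EuclideanSpace ℝ (Fin 3)) (3 * b) ∧ b ≤ cylRadius x}) => hx.1)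

/-- The `r²`-moment inside `B_{3b}` of anything is finite. (ns-idea-11 g11, ported.) [folklore] -/
theorem moment_ball_lt_top (A : Set (EuclideanSpace ℝ (Fin 3))) (b : ℝ) :
    ∫⁻ x in A ∩ Metric.ball (0 : EuclideanSpace ℝ (Fin 3)) (3 * b), ENNReal.ofReal (cylRadius x ^ 2) < ⊤ := by
  refine lt_of_le_of_lt (lintegral_mono_set Set.inter_subset_right) ?_
  have h1 : ∫⁻ x in Metric.ball (0 : EuclideanSpace ℝ (Fin 3)) (3 * b), ENNReal.ofReal (cylRadius x ^ 2) ≤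
      ∫⁻ _ in Metric.ball (0 : EuclideanSpace ℝ (Fin 3)) (3 * b), ENNReal.ofReal ((3 * b) ^ 2) := by
    refine setLIntegral_mono' measurableSet_ball fun x hx => ENNReal.ofReal_le_ofReal ?_
    have hxb : ‖x‖ < 3 * b := by simpa using hx
    have : cylRadius x ≤ ‖x‖ := by
      have h := (coord_bounds x).2
      have hc := cylRadius_sq x
      nlinarith [cylRadius_nonneg x, norm_nonneg x]
    nlinarith [cylRadius_nonneg x, norm_nonneg x]
  refine lt_of_le_of_lt h1 ?_
  rw [setLIntegral_const]
  exact ENNReal.mul_lt_top ENNReal.ofReal_lt_top measure_ball_lt_top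

/-- A continuous slice has finite `L²` mass on `B_{3b}`. (ns-idea-11 g11, ported.) [folklore] -/
theorem ball_sq_lt_top {v  : EuclideanSpace ℝ (Fin 3) → EuclideanSpace ℝ (Fin 3)} (hv : Continuous v) (b : ℝ) :
    ∫⁻ x in Metric.ball (0 : EuclideanSpace ℝ (Fin 3)) (3 * b), ‖v x‖ₑ ^ 2 < ⊤ := by
  obtain ⟨B, hB⟩ := (isCompact_closedBall (0 : EuclideanSpace ℝ (Fin 3)) (3 * b)).exists_bound_of_continuousOn hv.continuousOn
  refine lt_of_le_of_lt (lintegral_mono_set Metric.ball_subset_closedBall) ?_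
  have h1 : ∫⁻ x in Metric.closedBall (0 : EuclideanSpace ℝ (Fin 3)) (3 * b), ‖v x‖ₑ ^ 2 ≤
      ∫⁻ _ in Metric.closedBall (0 : EuclideanSpace ℝ (Fin 3)) (3 * b), ENNReal.ofReal (B ^ 2) := by
    refine setLIntegral_mono' measurableSet_closedBall fun x hx => ?_
    rw [← ofReal_norm, ← ENNReal.ofReal_pow (norm_nonneg _)]
    exact ENNReal.ofReal_le_ofReal (pow_le_pow_left₀ (norm_nonneg _) (hB x hx) 2)
  refine lt_of_le_of_lt h1 ?_
  rw [setLIntegral_const]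
  exact ENNReal.mul_lt_top ENNReal.ofReal_lt_top measure_closedBall_lt_top


/-- Per-slice AXIAL FLUX bound: `HaulingInequality` (δ-unfolded hypothesis `hHaul`) at the slice + `M_A ≤ m(s)` + `M·L(M) ≤ (2+4 log b)(m + b⁻²)` +
AM–GM (twice). (ns-idea-11 g11, ported; `Y = X_sS`.) [folklore] -/
theorem axial_flux_le {C : ℝ} (hC : 0 < C)
    (hHaul : ∀ b : ℝ, 1 ≤ b → ∀ v  : EuclideanSpace ℝ (Fin 3) → EuclideanSpace ℝ (Fin 3), ContDiff ℝ 1 v →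
      ∀ w : ℝ → ℝ, Measurable w → (∀ z : ℝ, |w z| ≤ 1) →
        ∀ A : Set (EuclideanSpace ℝ (Fin 3)), MeasurableSet A → A ⊆ {x : EuclideanSpace ℝ (Fin 3) | cylRadius x < 2 * b ∧ |x 2| < b} →
          |∫ x in A, w (x 2) * (v x) 2| ≤
            C * Real.sqrt (∫ x in {x : EuclideanSpace ℝ (Fin 3) | cylRadius x < 2 * b ∧ |x 2| < b}, ‖fderiv ℝ v x‖ ^ 2) *
                Real.sqrt ((∫ x in A, cylRadius x ^ 2) * (1 + Real.log b + max 0 (Real.log (b / (∫ x in A, cylRadius x ^ 2))))) +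
              C * Real.sqrt ((∫ x in A, cylRadius x ^ 2) / b ^ 2) * Real.sqrt (∫ x in {x : EuclideanSpace ℝ (Fin 3) | cylRadius x < 2 * b ∧ |x 2| < b}, ‖v x‖ ^ 2))
    {b : ℝ} (hb : 1 ≤ b) {u : ℝ → EuclideanSpace ℝ (Fin 3) → EuclideanSpace ℝ (Fin 3)} {p : ℝ → EuclideanSpace ℝ (Fin 3) → ℝ} (hcl : IsClassicalEulerSolutionOn (Set.Iio 0) 0 u p)
    {Y : Set (EuclideanSpace ℝ (Fin 3))} (hY : MeasurableSet Y)
    {w : ℝ → ℝ} (hw : Measurable w) (hw1 : ∀ z : ℝ, |w z| ≤ 1)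
    {s : ℝ} (hs0 : s < 0) {θ₁ θ₂ : ℝ} (hθ₁ : 0 < θ₁) (hθ₂ : 0 < θ₂) :
    |∫ x in Y ∩ {x : EuclideanSpace ℝ (Fin 3) | cylRadius x < 2 * b ∧ |x 2| < b}, w (x 2) * (u s x) 2| ≤
      C / 2 * (θ₁ * (∫⁻ x in {x : EuclideanSpace ℝ (Fin 3) | cylRadius x < 2 * b ∧ |x 2| < b}, ENNReal.ofReal (‖fderiv ℝ (u s) x‖ ^ 2)).toReal +
          (2 + 4 * Real.log b) *
            ((∫⁻ x in Y ∩ Metric.ball (0 : EuclideanSpace ℝ (Fin 3)) (3 * b), ENNReal.ofReal (cylRadius x ^ 2)).toReal + 1 / b ^ 2) / θ₁) +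
        C / 2 * (θ₂ * ((∫⁻ x in Y ∩ Metric.ball (0 : EuclideanSpace ℝ (Fin 3)) (3 * b), ENNReal.ofReal (cylRadius x ^ 2)).toReal / b ^ 2) +
          (∫⁻ x in Metric.ball (0 : EuclideanSpace ℝ (Fin 3)) (3 * b), ‖u s x‖ₑ ^ 2).toReal / θ₂) := by
  have hb0 : 0 < b := by linarith
  set A : Set (EuclideanSpace ℝ (Fin 3)) := Y ∩ {x : EuclideanSpace ℝ (Fin 3) | cylRadius x < 2 * b ∧ |x 2| < b} with hAdef
  set Dh : ℝ≥0∞ := ∫⁻ x in {x : EuclideanSpace ℝ (Fin 3) | cylRadius x < 2 * b ∧ |x 2| < b}, ENNReal.ofReal (‖fderiv ℝ (u s) x‖ ^ 2) with hDh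
  set mh : ℝ≥0∞ := ∫⁻ x in Y ∩ Metric.ball (0 : EuclideanSpace ℝ (Fin 3)) (3 * b), ENNReal.ofReal (cylRadius x ^ 2) with hmh
  set Uh : ℝ≥0∞ := ∫⁻ x in Metric.ball (0 : EuclideanSpace ℝ (Fin 3)) (3 * b), ‖u s x‖ₑ ^ 2 with hUh
  have hA : MeasurableSet A := hY.inter (measurableSet_solidCyl' b)
  have hAcyl : A ⊆ {x : EuclideanSpace ℝ (Fin 3) | cylRadius x < 2 * b ∧ |x 2| < b} := Set.inter_subset_right
  have hv : ContDiff ℝ 1 (u s) := (hcl.contDiff_velocity (show s ∈ Set.Iio 0 from hs0)).of_le (by norm_cast)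
  have hvc : Continuous (u s) := hv.continuous
  have hDc : Continuous (fderiv ℝ (u s)) := hv.continuous_fderiv one_ne_zero
  have hH := hHaul b hb (u s) hv w hw hw1 A hA hAcyl
  -- (E1) the Dirichlet integral as a lintegral
  have hE1 : ∫ x in {x : EuclideanSpace ℝ (Fin 3) | cylRadius x < 2 * b ∧ |x 2| < b}, ‖fderiv ℝ (u s) x‖ ^ 2 = Dh.toReal := by
    rw [hDh]
    exact integral_eq_lintegral_of_nonneg_ae (ae_of_all _ fun x => by positivity) (hDc.norm.pow 2).aestronglyMeasurable
  -- (E2) the axis moment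
  set M : ℝ := (∫ x in A, cylRadius x ^ 2) with hMdef
  have hM0 : 0 ≤ M := integral_nonneg fun x => sq_nonneg _
  have hmh_fin : mh ≠ ⊤ := (moment_ball_lt_top (Y) b).ne
  have hMm : M ≤ mh.toReal := by
    have h1 : M = (∫⁻ x in A, ENNReal.ofReal (cylRadius x ^ 2)).toReal := by
      rw [hMdef]
      exact integral_eq_lintegral_of_nonneg_ae (ae_of_all _ fun x => sq_nonneg _)
        (continuous_cylRadius.pow 2).aestronglyMeasurable
    rw [h1]
    refine ENNReal.toReal_mono hmh_fin (lintegral_mono_set ?_)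
    exact Set.inter_subset_inter_right _ (solidCyl_subset_ball' hb0)
  -- (E3) the L² mass
  have hUh_fin : Uh ≠ ⊤ := (ball_sq_lt_top hvc b).ne
  have hU : ∫ x in {x : EuclideanSpace ℝ (Fin 3) | cylRadius x < 2 * b ∧ |x 2| < b}, ‖u s x‖ ^ 2 ≤ Uh.toReal := by
    have h1 : ∫ x in {x : EuclideanSpace ℝ (Fin 3) | cylRadius x < 2 * b ∧ |x 2| < b}, ‖u s x‖ ^ 2 = (∫⁻ x in {x : EuclideanSpace ℝ (Fin 3) | cylRadius x < 2 * b ∧ |x 2| < b}, ENNReal.ofReal (‖u s x‖ ^ 2)).toReal :=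
      integral_eq_lintegral_of_nonneg_ae (ae_of_all _ fun x => by positivity) (hvc.norm.pow 2).aestronglyMeasurable
    rw [h1]
    refine ENNReal.toReal_mono hUh_fin ?_
    calc ∫⁻ x in {x : EuclideanSpace ℝ (Fin 3) | cylRadius x < 2 * b ∧ |x 2| < b}, ENNReal.ofReal (‖u s x‖ ^ 2) = ∫⁻ x in {x : EuclideanSpace ℝ (Fin 3) | cylRadius x < 2 * b ∧ |x 2| < b}, ‖u s x‖ₑ ^ 2 := by
          refine lintegral_congr fun x => ?_
          rw [← ofReal_norm, ENNReal.ofReal_pow (norm_nonneg _)]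
      _ ≤ Uh := lintegral_mono_set (solidCyl_subset_ball' hb0)
  -- the `L`-factor
  have hlogb : 0 ≤ Real.log b := Real.log_nonneg hb
  have hL0 : 0 ≤ 1 + Real.log b + max 0 (Real.log (b / M)) := by positivity
  have hML : M * (1 + Real.log b + max 0 (Real.log (b / M))) ≤ (2 + 4 * Real.log b) * (mh.toReal + 1 / b ^ 2) :=
    moment_log_bound hb hM0 hMm
  -- first term
  have hT1 : C * Real.sqrt (∫ x in {x : EuclideanSpace ℝ (Fin 3) | cylRadius x < 2 * b ∧ |x 2| < b}, ‖fderiv ℝ (u s) x‖ ^ 2) *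
        Real.sqrt (M * (1 + Real.log b + max 0 (Real.log (b / M)))) ≤
      C / 2 * (θ₁ * Dh.toReal + (2 + 4 * Real.log b) * (mh.toReal + 1 / b ^ 2) / θ₁) := by
    rw [hE1, mul_assoc]
    have h1 := sqrt_mul_sqrt_le_amgm (x := Dh.toReal) (y := M * (1 + Real.log b + max 0 (Real.log (b / M))))
      ENNReal.toReal_nonneg (by positivity) hθ₁
    have h2 : (θ₁ * Dh.toReal + M * (1 + Real.log b + max 0 (Real.log (b / M))) / θ₁) / 2 ≤
        (θ₁ * Dh.toReal + (2 + 4 * Real.log b) * (mh.toReal + 1 / b ^ 2) / θ₁) / 2 :=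
      by have := div_le_div_of_nonneg_right hML hθ₁.le; linarith
    calc C * (Real.sqrt Dh.toReal * Real.sqrt (M * (1 + Real.log b + max 0 (Real.log (b / M)))))
        ≤ C * ((θ₁ * Dh.toReal + (2 + 4 * Real.log b) * (mh.toReal + 1 / b ^ 2) / θ₁) / 2) :=
          mul_le_mul_of_nonneg_left (h1.trans h2) hC.le
      _ = _ := by ring
  -- second term
  have hT2 : C * Real.sqrt (M / b ^ 2) * Real.sqrt (∫ x in {x : EuclideanSpace ℝ (Fin 3) | cylRadius x < 2 * b ∧ |x 2| < b}, ‖u s x‖ ^ 2) ≤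
      C / 2 * (θ₂ * (mh.toReal / b ^ 2) + Uh.toReal / θ₂) := by
    rw [mul_assoc]
    have h1 : Real.sqrt (M / b ^ 2) ≤ Real.sqrt (mh.toReal / b ^ 2) :=
      Real.sqrt_le_sqrt (div_le_div_of_nonneg_right hMm (by positivity))
    have h2 : Real.sqrt (∫ x in {x : EuclideanSpace ℝ (Fin 3) | cylRadius x < 2 * b ∧ |x 2| < b}, ‖u s x‖ ^ 2) ≤ Real.sqrt Uh.toReal := Real.sqrt_le_sqrt hU
    have h3 := sqrt_mul_sqrt_le_amgm (x := mh.toReal / b ^ 2) (y := Uh.toReal) (by positivity) ENNReal.toReal_nonneg hθ₂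
    calc C * (Real.sqrt (M / b ^ 2) * Real.sqrt (∫ x in {x : EuclideanSpace ℝ (Fin 3) | cylRadius x < 2 * b ∧ |x 2| < b}, ‖u s x‖ ^ 2))
        ≤ C * (Real.sqrt (mh.toReal / b ^ 2) * Real.sqrt Uh.toReal) :=
          mul_le_mul_of_nonneg_left (mul_le_mul h1 h2 (Real.sqrt_nonneg _) (Real.sqrt_nonneg _)) hC.le
      _ ≤ C * ((θ₂ * (mh.toReal / b ^ 2) + Uh.toReal / θ₂) / 2) := mul_le_mul_of_nonneg_left h3 hC.le
      _ = _ := by ring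
  exact hH.trans (add_le_add hT1 hT2)


/-- ★ Per-slice MAJORANT: flux + shell traffic `≤ α·D̂(s) + β·m̂(s) + γ` with the bookkeeping constants of the proof of H4c. (ns-idea-11 g11, ported;
`Y = X_sS`.) [folklore] -/
theorem slice_majorant {C : ℝ} (hC : 0 < C)
    (hHaul : ∀ b : ℝ, 1 ≤ b → ∀ v  : EuclideanSpace ℝ (Fin 3) → EuclideanSpace ℝ (Fin 3), ContDiff ℝ 1 v →
      ∀ w : ℝ → ℝ, Measurable w → (∀ z : ℝ, |w z| ≤ 1) →
        ∀ A : Set (EuclideanSpace ℝ (Fin 3)), MeasurableSet A → A ⊆ {x : EuclideanSpace ℝ (Fin 3) | cylRadius x < 2 * b ∧ |x 2| < b} →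
          |∫ x in A, w (x 2) * (v x) 2| ≤
            C * Real.sqrt (∫ x in {x : EuclideanSpace ℝ (Fin 3) | cylRadius x < 2 * b ∧ |x 2| < b}, ‖fderiv ℝ v x‖ ^ 2) *
                Real.sqrt ((∫ x in A, cylRadius x ^ 2) * (1 + Real.log b + max 0 (Real.log (b / (∫ x in A, cylRadius x ^ 2))))) +
              C * Real.sqrt ((∫ x in A, cylRadius x ^ 2) / b ^ 2) * Real.sqrt (∫ x in {x : EuclideanSpace ℝ (Fin 3) | cylRadius x < 2 * b ∧ |x 2| < b}, ‖v x‖ ^ 2))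
    {b : ℝ} (hb : 1 ≤ b) {u : ℝ → EuclideanSpace ℝ (Fin 3) → EuclideanSpace ℝ (Fin 3)} {p : ℝ → EuclideanSpace ℝ (Fin 3) → ℝ} (hcl : IsClassicalEulerSolutionOn (Set.Iio 0) 0 u p)
    {Y : Set (EuclideanSpace ℝ (Fin 3))} (hY : MeasurableSet Y)
    {w : ℝ → ℝ} (hw : Measurable w) (hw1 : ∀ z : ℝ, |w z| ≤ 1)
    {s : ℝ} (hs0 : s < 0)
    {U₀ : ℝ} (hU₀ : 0 ≤ U₀) (hUs : ∫⁻ x in Metric.ball (0 : EuclideanSpace ℝ (Fin 3)) (3 * b), ‖u s x‖ₑ ^ 2 ≤ ENNReal.ofReal U₀)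
    {θ₁ θ₂ θ₃ : ℝ} (hθ₁ : 0 < θ₁) (hθ₂ : 0 < θ₂) (hθ₃ : 0 < θ₃) :
    ‖∫ x in Y ∩ {x : EuclideanSpace ℝ (Fin 3) | cylRadius x < 2 * b ∧ |x 2| < b}, w (x 2) * (u s x) 2‖ₑ + ∫⁻ x in Y ∩ {x : EuclideanSpace ℝ (Fin 3) | x ∈ Metric.ball (0 : EuclideanSpace ℝ (Fin 3)) (3 * b) ∧ b ≤ cylRadius x}, ‖u s x‖ₑ ≤
      ENNReal.ofReal (C / 2 * θ₁) * (∫⁻ x in {x : EuclideanSpace ℝ (Fin 3) | cylRadius x < 2 * b ∧ |x 2| < b}, ENNReal.ofReal (‖fderiv ℝ (u s) x‖ ^ 2)) +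
        ENNReal.ofReal (C / 2 * ((2 + 4 * Real.log b) / θ₁) + C / 2 * (θ₂ / b ^ 2) + θ₃ / (2 * b ^ 2)) *
          (∫⁻ x in Y ∩ Metric.ball (0 : EuclideanSpace ℝ (Fin 3)) (3 * b), ENNReal.ofReal (cylRadius x ^ 2)) +
        ENNReal.ofReal (C / 2 * ((2 + 4 * Real.log b) / (θ₁ * b ^ 2)) + C / 2 * (U₀ / θ₂) + U₀ / (2 * θ₃)) := by
  have hb0 : 0 < b := by linarith
  set Dh : ℝ≥0∞ := ∫⁻ x in {x : EuclideanSpace ℝ (Fin 3) | cylRadius x < 2 * b ∧ |x 2| < b}, ENNReal.ofReal (‖fderiv ℝ (u s) x‖ ^ 2) with hDh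
  set mh : ℝ≥0∞ := ∫⁻ x in Y ∩ Metric.ball (0 : EuclideanSpace ℝ (Fin 3)) (3 * b), ENNReal.ofReal (cylRadius x ^ 2) with hmh
  set Uh : ℝ≥0∞ := ∫⁻ x in Metric.ball (0 : EuclideanSpace ℝ (Fin 3)) (3 * b), ‖u s x‖ₑ ^ 2 with hUh
  have hlogb : 0 ≤ Real.log b := Real.log_nonneg hb
  set G : ℝ := 2 + 4 * Real.log b with hG
  have hG0 : 0 ≤ G := by positivity
  have hU : Uh.toReal ≤ U₀ := ENNReal.toReal_le_of_le_ofReal hU₀ hUs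
  -- the flux
  have hflux := axial_flux_le hC hHaul hb hcl hY hw hw1 hs0 hθ₁ hθ₂
  have hflux' : |∫ x in Y ∩ {x : EuclideanSpace ℝ (Fin 3) | cylRadius x < 2 * b ∧ |x 2| < b}, w (x 2) * (u s x) 2| ≤
      C / 2 * θ₁ * Dh.toReal + (C / 2 * (G / θ₁) + C / 2 * (θ₂ / b ^ 2)) * mh.toReal +
        (C / 2 * (G / (θ₁ * b ^ 2)) + C / 2 * (U₀ / θ₂)) := by
    refine hflux.trans ?_
    have h1 : C / 2 * (θ₂ * (mh.toReal / b ^ 2) + Uh.toReal / θ₂) ≤ C / 2 * (θ₂ * (mh.toReal / b ^ 2) + U₀ / θ₂) := by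
      have := div_le_div_of_nonneg_right hU hθ₂.le
      nlinarith
    have h2 : C / 2 * (θ₁ * Dh.toReal + G * (mh.toReal + 1 / b ^ 2) / θ₁) + C / 2 * (θ₂ * (mh.toReal / b ^ 2) + U₀ / θ₂) =
        C / 2 * θ₁ * Dh.toReal + (C / 2 * (G / θ₁) + C / 2 * (θ₂ / b ^ 2)) * mh.toReal +
          (C / 2 * (G / (θ₁ * b ^ 2)) + C / 2 * (U₀ / θ₂)) := by
      field_simp
      ring
    linarith
  have hA0 : 0 ≤ C / 2 * θ₁ * Dh.toReal := by positivity
  have hB0 : 0 ≤ (C / 2 * (G / θ₁) + C / 2 * (θ₂ / b ^ 2)) * mh.toReal := by positivity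
  have hC0 : 0 ≤ C / 2 * (G / (θ₁ * b ^ 2)) + C / 2 * (U₀ / θ₂) := by positivity
  have hI : ‖∫ x in Y ∩ {x : EuclideanSpace ℝ (Fin 3) | cylRadius x < 2 * b ∧ |x 2| < b}, w (x 2) * (u s x) 2‖ₑ ≤
      ENNReal.ofReal (C / 2 * θ₁) * Dh + ENNReal.ofReal (C / 2 * (G / θ₁) + C / 2 * (θ₂ / b ^ 2)) * mh +
        ENNReal.ofReal (C / 2 * (G / (θ₁ * b ^ 2)) + C / 2 * (U₀ / θ₂)) := by
    rw [Real.enorm_eq_ofReal_abs]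
    refine (ENNReal.ofReal_le_ofReal hflux').trans ?_
    rw [ENNReal.ofReal_add (add_nonneg hA0 hB0) hC0, ENNReal.ofReal_add hA0 hB0,
      ENNReal.ofReal_mul (by positivity : 0 ≤ C / 2 * θ₁),
      ENNReal.ofReal_mul (by positivity : 0 ≤ C / 2 * (G / θ₁) + C / 2 * (θ₂ / b ^ 2))]
    gcongr
    · exact ENNReal.ofReal_toReal_le
    · exact ENNReal.ofReal_toReal_le
  -- the shell
  have hT : ∫⁻ x in Y ∩ {x : EuclideanSpace ℝ (Fin 3) | x ∈ Metric.ball (0 : EuclideanSpace ℝ (Fin 3)) (3 * b) ∧ b ≤ cylRadius x}, ‖u s x‖ₑ ≤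
      ENNReal.ofReal (θ₃ / (2 * b ^ 2)) * mh + ENNReal.ofReal (U₀ / (2 * θ₃)) := by
    refine (shell_traffic_le hcl hY b hs0 hθ₃).trans ?_
    have h1 : ENNReal.ofReal (θ₃ / 2) * volume (Y ∩ {x : EuclideanSpace ℝ (Fin 3) | x ∈ Metric.ball (0 : EuclideanSpace ℝ (Fin 3)) (3 * b) ∧ b ≤ cylRadius x}) ≤ ENNReal.ofReal (θ₃ / (2 * b ^ 2)) * mh := by
      have h2 : ENNReal.ofReal (θ₃ / 2) = ENNReal.ofReal (θ₃ / (2 * b ^ 2)) * ENNReal.ofReal (b ^ 2) := by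
        rw [← ENNReal.ofReal_mul (by positivity)]
        congr 1
        field_simp
      rw [h2, mul_assoc]
      exact mul_le_mul_of_nonneg_left (shell_volume_le hY hb0.le) bot_le
    have h3 : ENNReal.ofReal (1 / (2 * θ₃)) * Uh ≤ ENNReal.ofReal (U₀ / (2 * θ₃)) := by
      calc ENNReal.ofReal (1 / (2 * θ₃)) * Uh ≤ ENNReal.ofReal (1 / (2 * θ₃)) * ENNReal.ofReal U₀ :=
            mul_le_mul_of_nonneg_left hUs bot_le
        _ = ENNReal.ofReal (U₀ / (2 * θ₃)) := by
            rw [← ENNReal.ofReal_mul (by positivity)]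
            congr 1
            field_simp
    exact add_le_add h1 h3
  -- sum
  have hβ : ENNReal.ofReal (C / 2 * (G / θ₁) + C / 2 * (θ₂ / b ^ 2)) + ENNReal.ofReal (θ₃ / (2 * b ^ 2)) =
      ENNReal.ofReal (C / 2 * (G / θ₁) + C / 2 * (θ₂ / b ^ 2) + θ₃ / (2 * b ^ 2)) := by
    rw [← ENNReal.ofReal_add (by positivity) (by positivity)]
  have hγ : ENNReal.ofReal (C / 2 * (G / (θ₁ * b ^ 2)) + C / 2 * (U₀ / θ₂)) + ENNReal.ofReal (U₀ / (2 * θ₃)) =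
      ENNReal.ofReal (C / 2 * (G / (θ₁ * b ^ 2)) + C / 2 * (U₀ / θ₂) + U₀ / (2 * θ₃)) := by
    rw [← ENNReal.ofReal_add (by positivity) (by positivity)]
  calc ‖∫ x in Y ∩ {x : EuclideanSpace ℝ (Fin 3) | cylRadius x < 2 * b ∧ |x 2| < b}, w (x 2) * (u s x) 2‖ₑ + ∫⁻ x in Y ∩ {x : EuclideanSpace ℝ (Fin 3) | x ∈ Metric.ball (0 : EuclideanSpace ℝ (Fin 3)) (3 * b) ∧ b ≤ cylRadius x}, ‖u s x‖ₑ
      ≤ (ENNReal.ofReal (C / 2 * θ₁) * Dh + ENNReal.ofReal (C / 2 * (G / θ₁) + C / 2 * (θ₂ / b ^ 2)) * mh +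
          ENNReal.ofReal (C / 2 * (G / (θ₁ * b ^ 2)) + C / 2 * (U₀ / θ₂))) +
        (ENNReal.ofReal (θ₃ / (2 * b ^ 2)) * mh + ENNReal.ofReal (U₀ / (2 * θ₃))) := add_le_add hI hT
    _ = ENNReal.ofReal (C / 2 * θ₁) * Dh +
          (ENNReal.ofReal (C / 2 * (G / θ₁) + C / 2 * (θ₂ / b ^ 2)) + ENNReal.ofReal (θ₃ / (2 * b ^ 2))) * mh +
        (ENNReal.ofReal (C / 2 * (G / (θ₁ * b ^ 2)) + C / 2 * (U₀ / θ₂)) + ENNReal.ofReal (U₀ / (2 * θ₃))) := by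
        ring
    _ = _ := by rw [hβ, hγ]

end Summit.NavierStokesRegularity.NavierStokesRegularity.Theorems.PowerGaugeEulerLiouville.CasimirHaul

end
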